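import Mathlib
import HarnessLib

/-!
# Sections of `ζ` beyond `σ = 1`: prime sums by partial summation against `θ`, and block sums

Barrier catalogue `Literature/Barriers/RiemannHypothesis/`, companion of `TuranPartialSums.lean`
(prime-sum layer of the "vertical shift" proof of `TuranPartialSums` for large `N`). Everything is
PROVED and elementary; no number-theoretic input is used here (the envelope for `θ` enters only in
`TuranPartialSumsShiftMain.lean`).

## Contents (namespace `Literature.Barriers.RiemannHypothesis.TuranShift`)

* `theta_natCast_sub_theta` — `θ(n) − θ(n−1) = log n · 𝟙[n prime]` (`n ≥ 1`).
* `abel_Ioc` — discrete summation by parts: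
  `∑_{a<n≤b} (A(n) − A(n−1)) g(n) = A(b)g(b) − A(a)g(a+1) − ∑_{a<n<b} A(n)(g(n+1) − g(n))`.
* `sum_primes_mul_log_eq` — for `g : ℕ → ℂ` and `1 ≤ M < N`:
  `∑_{M<p≤N, p prime} log p · g(p) = ∑_{M<n≤N} g(n) + Err`,
  `Err = E(N)g(N) − E(M)g(M+1) − ∑_{M<n<N} E(n)(g(n+1) − g(n))`, `E(n) = θ(n) − n`
  (`primeSumErr`); `norm_primeSumErr_le` —
  `‖Err‖ ≤ e(N)‖g(N)‖ + e(M)‖g(M+1)‖ + ∑_{M<n<N} e(n)‖g(n+1) − g(n)‖` whenever `|θ(n) − n| ≤ e(n)`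
  on `[M, N]`.
* `sum_Ioc_mul_apply_div_eq_sum_fiber` — grouping `∑_{M<n≤N} h(n) G(N/n)` by the value
  `m = N/n ∈ [1, M]` (`N < (M+1)²`): the fibre of `m` is the block `(max(M, N/(m+1)), N/m]`.
* `norm_sum_Ioc_sub_integral_le` — a block sum against its integral:
  `‖∑_{a<n≤b} h(n) − ∫_a^b h‖ ≤ ½ ∑_{a<n≤b} D(n−1)` when `‖h'‖ ≤ D`, `D` antitone.
* `sum_mul_norm_sub_le_integral` — `∑_{a≤n<b} e(n)‖g(n+1) − g(n)‖ ≤ ∫_a^b e·P` when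
  `‖g(n+1) − g(n)‖ ≤ ∫_n^{n+1} P` and `e` is non-decreasing.

## References

* Summation by parts against `θ` (e.g. Hardy–Wright §22.5; Rosser–Schoenfeld 1962, §4). [folklore]
-/

noncomputable section

open Real Set MeasureTheory intervalIntegral Finset
open scoped Chebyshev

namespace Literature.Barriers.RiemannHypothesis

namespace TuranShift

/-! ## `θ` at consecutive integers -/

/-- `θ(n) − θ(n − 1) = log n` if `n` is prime and `0` otherwise (`n ≥ 1`). [folklore] -/
theorem theta_natCast_sub_theta {n : ℕ} (hn : 1 ≤ n) :
    θ (n : ℝ) - θ ((n - 1 : ℕ) : ℝ) = if n.Prime then Real.log n else 0 := by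
  rw [Chebyshev.theta, Chebyshev.theta, Nat.floor_natCast, Nat.floor_natCast]
  have h : Finset.Ioc 0 n = insert n (Finset.Ioc 0 (n - 1)) := by
    ext k; simp only [Finset.mem_Ioc, Finset.mem_insert]; omega
  rw [h, Finset.filter_insert]
  split_ifs with hp
  · rw [Finset.sum_insert (by simp)]
    ring
  · ring

/-! ## Summation by parts -/

/-- **Discrete summation by parts**: for `a < b`,
`∑_{a<n≤b} (A(n) − A(n−1)) g(n) = A(b)g(b) − A(a)g(a+1) − ∑_{a<n<b} A(n)(g(n+1) − g(n))`.
[folklore] -/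
theorem abel_Ioc {R : Type*} [CommRing R] (A g : ℕ → R) {a b : ℕ} (hab : a < b) :
    ∑ n ∈ Finset.Ioc a b, (A n - A (n - 1)) * g n =
      A b * g b - A a * g (a + 1) - ∑ n ∈ Finset.Ico (a + 1) b, A n * (g (n + 1) - g n) := by
  induction b, hab using Nat.le_induction with
  | base =>
    simp only [Nat.Ioc_succ_singleton, Finset.sum_singleton, Nat.add_sub_cancel, Finset.Ico_self,
      Finset.sum_empty, sub_zero]
    ring
  | succ b hb ih =>
    rw [Finset.sum_Ioc_succ_top (by omega), ih, Finset.sum_Ico_succ_top (by omega),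
      Nat.add_sub_cancel]
    ring

/-! ## Prime sums against `θ` -/

/-- The error functional of a prime sum: `E(N)g(N) − E(M)g(M+1) − ∑_{M<n<N} E(n)(g(n+1) − g(n))`
with `E(n) = θ(n) − n`. [folklore] -/
def primeSumErr (g : ℕ → ℂ) (M N : ℕ) : ℂ :=
  ((θ (N : ℝ) - N : ℝ) : ℂ) * g N - ((θ (M : ℝ) - M : ℝ) : ℂ) * g (M + 1) -
    ∑ n ∈ Finset.Ico (M + 1) N, ((θ (n : ℝ) - n : ℝ) : ℂ) * (g (n + 1) - g n)

/-- **Prime sums by partial summation against `θ`**: for `g : ℕ → ℂ` and `1 ≤ M < N`,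
`∑_{M<p≤N, p prime} log p · g(p) = ∑_{M<n≤N} g(n) + primeSumErr g M N`. [folklore] -/
theorem sum_primes_mul_log_eq (g : ℕ → ℂ) {M N : ℕ} (hM : 1 ≤ M) (hMN : M < N) :
    ∑ p ∈ (Finset.Ioc M N).filter Nat.Prime, (Real.log p : ℂ) * g p =
      ∑ n ∈ Finset.Ioc M N, g n + primeSumErr g M N := by
  -- the prime sum as a sum of `θ`-increments
  have h1 : ∑ p ∈ (Finset.Ioc M N).filter Nat.Prime, (Real.log p : ℂ) * g p =
      ∑ n ∈ Finset.Ioc M N, ((θ (n : ℝ) : ℂ) - (θ ((n - 1 : ℕ) : ℝ) : ℂ)) * g n := by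
    rw [Finset.sum_filter]
    refine Finset.sum_congr rfl fun n hn ↦ ?_
    have hn1 : 1 ≤ n := by have := (Finset.mem_Ioc.1 hn).1; omega
    rw [← Complex.ofReal_sub, theta_natCast_sub_theta hn1]
    split_ifs <;> simp
  -- summation by parts twice: against `θ` and against the identity
  have hA := abel_Ioc (fun n : ℕ ↦ (θ (n : ℝ) : ℂ)) g hMN
  have hI := abel_Ioc (fun n : ℕ ↦ ((n : ℝ) : ℂ)) g hMN
  have hI' : ∑ n ∈ Finset.Ioc M N, (((n : ℝ) : ℂ) - (((n - 1 : ℕ) : ℝ) : ℂ)) * g n =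
      ∑ n ∈ Finset.Ioc M N, g n := by
    refine Finset.sum_congr rfl fun n hn ↦ ?_
    have hn1 : 1 ≤ n := by have := (Finset.mem_Ioc.1 hn).1; omega
    rw [Nat.cast_sub hn1]
    push_cast
    ring
  have hE : primeSumErr g M N =
      ((θ (N : ℝ) : ℂ) * g N - (θ (M : ℝ) : ℂ) * g (M + 1) -
          ∑ n ∈ Finset.Ico (M + 1) N, (θ (n : ℝ) : ℂ) * (g (n + 1) - g n)) -
        (((N : ℝ) : ℂ) * g N - ((M : ℝ) : ℂ) * g (M + 1) -
          ∑ n ∈ Finset.Ico (M + 1) N, ((n : ℝ) : ℂ) * (g (n + 1) - g n)) := by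
    rw [primeSumErr]
    push_cast
    simp only [sub_mul, Finset.sum_sub_distrib]
    ring
  rw [h1, hA, hE, ← hI', hI]
  ring

/-- **The error is controlled by any envelope of `|θ(n) − n|`**: if `|θ(n) − n| ≤ e(n)` for
`M ≤ n ≤ N` then
`‖primeSumErr g M N‖ ≤ e(N)‖g(N)‖ + e(M)‖g(M+1)‖ + ∑_{M<n<N} e(n)‖g(n+1) − g(n)‖`. [folklore] -/
theorem norm_primeSumErr_le (g : ℕ → ℂ) {M N : ℕ} {e : ℕ → ℝ}
    (he : ∀ n : ℕ, M ≤ n → n ≤ N → |θ (n : ℝ) - n| ≤ e n) (hMN : M ≤ N) :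
    ‖primeSumErr g M N‖ ≤ e N * ‖g N‖ + e M * ‖g (M + 1)‖ +
      ∑ n ∈ Finset.Ico (M + 1) N, e n * ‖g (n + 1) - g n‖ := by
  unfold primeSumErr
  have hb : ∀ n : ℕ, M ≤ n → n ≤ N → ∀ z : ℂ,
      ‖((θ (n : ℝ) - n : ℝ) : ℂ) * z‖ ≤ e n * ‖z‖ := by
    intro n h1 h2 z
    rw [norm_mul, Complex.norm_real, Real.norm_eq_abs]
    exact mul_le_mul_of_nonneg_right (he n h1 h2) (norm_nonneg _)
  refine (norm_sub_le _ _).trans (add_le_add ((norm_sub_le _ _).trans (add_le_add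
    (hb N hMN le_rfl _) (hb M le_rfl hMN _))) ((norm_sum_le _ _).trans
    (Finset.sum_le_sum fun n hn ↦ ?_)))
  have hn := Finset.mem_Ico.1 hn
  exact hb n (by omega) (by omega) _

/-! ## Grouping a sum by the value of `N / n` -/

/-- For `n, m ≥ 1`: `N / n = m ↔ N/(m+1) < n ≤ N/m` (natural division). [folklore] -/
theorem div_eq_iff_mem_block {N n m : ℕ} (hn : 1 ≤ n) (hm : 1 ≤ m) :
    N / n = m ↔ N / (m + 1) < n ∧ n ≤ N / m := by
  rw [Nat.div_lt_iff_lt_mul (by omega), Nat.le_div_iff_mul_le (by omega)]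
  constructor
  · rintro rfl
    refine ⟨?_, ?_⟩
    · have := Nat.lt_succ_iff.2 (le_refl (N / n))
      have h := (Nat.div_lt_iff_lt_mul (by omega)).1 (Nat.lt_succ_self (N / n))
      rw [Nat.mul_comm] at h
      exact h
    · rw [Nat.mul_comm]; exact Nat.div_mul_le_self N n
  · rintro ⟨h1, h2⟩
    apply le_antisymm
    · by_contra hlt
      push Not at hlt
      have h3 : (m + 1) * n ≤ N := by
        calc (m + 1) * n ≤ (N / n) * n := Nat.mul_le_mul_right n hlt
          _ ≤ N := Nat.div_mul_le_self N n
      rw [Nat.mul_comm] at h1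
      omega
    · exact (Nat.le_div_iff_mul_le (by omega)).2 (by rw [Nat.mul_comm]; exact h2)

/-- **Grouping by blocks.** For `1 ≤ M`, `N < (M+1)²` and any `h`, `G`:
`∑_{M<n≤N} h(n) G(N/n) = ∑_{m=1}^{M} G(m) ∑_{n ∈ (max(M, N/(m+1)), N/m]} h(n)`. [folklore] -/
theorem sum_Ioc_mul_apply_div_eq_sum_fiber {R : Type*} [CommRing R] (h : ℕ → R) (G : ℕ → R)
    {M N : ℕ} (hM : 1 ≤ M) (hN : N < (M + 1) * (M + 1)) :
    ∑ n ∈ Finset.Ioc M N, h n * G (N / n) =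
      ∑ m ∈ Finset.Icc 1 M, G m * ∑ n ∈ Finset.Ioc (max M (N / (m + 1))) (N / m), h n := by
  have hmaps : ∀ n ∈ Finset.Ioc M N, N / n ∈ Finset.Icc 1 M := by
    intro n hn
    have hn := Finset.mem_Ioc.1 hn
    refine Finset.mem_Icc.2 ⟨(Nat.one_le_div_iff (by omega)).2 hn.2, ?_⟩
    have h1 : N / n ≤ N / (M + 1) := Nat.div_le_div_left (by omega) (by omega)
    have h2 : N / (M + 1) < M + 1 := Nat.div_lt_of_lt_mul hN
    omega
  rw [← Finset.sum_fiberwise_of_maps_to hmaps]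
  refine Finset.sum_congr rfl fun m hm ↦ ?_
  have hm1 : 1 ≤ m := (Finset.mem_Icc.1 hm).1
  have hset : (Finset.Ioc M N).filter (fun n ↦ N / n = m) =
      Finset.Ioc (max M (N / (m + 1))) (N / m) := by
    ext n
    simp only [Finset.mem_filter, Finset.mem_Ioc, max_lt_iff]
    constructor
    · rintro ⟨⟨h1, h2⟩, h3⟩
      have := (div_eq_iff_mem_block (by omega) hm1).1 h3
      exact ⟨⟨h1, this.1⟩, this.2⟩
    · rintro ⟨⟨h1, h2⟩, h3⟩
      have hn1 : 1 ≤ n := by omega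
      exact ⟨⟨h1, h3.trans (Nat.div_le_self N m)⟩, (div_eq_iff_mem_block hn1 hm1).2 ⟨h2, h3⟩⟩
  rw [hset, Finset.mul_sum]
  refine Finset.sum_congr rfl fun n hn ↦ ?_
  have hn' := Finset.mem_Ioc.1 hn
  have hn1 : 1 ≤ n := by have := hn'.1; rw [max_lt_iff] at this; omega
  rw [(div_eq_iff_mem_block hn1 hm1).2 ⟨(max_lt_iff.1 hn'.1).2, hn'.2⟩, mul_comm]

/-! ## A block sum against its integral -/

/-- **A sum against its integral, to first order.** For naturals `a ≤ b`, if `h` has derivative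
`h'` on `[a, b]` with `‖h'(t)‖ ≤ D(t)` there and `D` antitone on `[a, b]`, then
`‖∑_{a<n≤b} h(n) − ∫_a^b h‖ ≤ ½ ∑_{a<n≤b} D(n − 1)`. [folklore] -/
theorem norm_sum_Ioc_sub_integral_le {h h' : ℝ → ℂ} {D : ℝ → ℝ} {a b : ℕ} (hab : a ≤ b)
    (hderiv : ∀ t ∈ Icc (a : ℝ) b, HasDerivAt h (h' t) t)
    (hD : ∀ t ∈ Icc (a : ℝ) b, ‖h' t‖ ≤ D t) (hDanti : AntitoneOn D (Icc (a : ℝ) b)) :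
    ‖∑ n ∈ Finset.Ioc a b, h n - ∫ t in (a : ℝ)..b, h t‖ ≤
      1 / 2 * ∑ n ∈ Finset.Ioc a b, D ((n : ℝ) - 1) := by
  induction b, hab using Nat.le_induction with
  | base => simp
  | succ b hb ih =>
    have hb' : (a : ℝ) ≤ b := by exact_mod_cast hb
    have hbb : (b : ℝ) ≤ ((b + 1 : ℕ) : ℝ) := by push_cast; linarith
    have hsub : Icc (a : ℝ) b ⊆ Icc (a : ℝ) ((b + 1 : ℕ) : ℝ) := fun t ht ↦
      ⟨ht.1, ht.2.trans hbb⟩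
    have hsub' : Icc (b : ℝ) ((b + 1 : ℕ) : ℝ) ⊆ Icc (a : ℝ) ((b + 1 : ℕ) : ℝ) := fun t ht ↦
      ⟨hb'.trans ht.1, ht.2⟩
    have hcont : ContinuousOn h (Icc (a : ℝ) ((b + 1 : ℕ) : ℝ)) := fun t ht ↦
      (hderiv t ht).continuousAt.continuousWithinAt
    have ih' := ih (fun t ht ↦ hderiv t (hsub ht)) (fun t ht ↦ hD t (hsub ht))
      (hDanti.mono hsub)
    have hint1 : IntervalIntegrable h volume (a : ℝ) b :=
      (hcont.mono hsub).intervalIntegrable_of_Icc hb'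
    have hint2 : IntervalIntegrable h volume (b : ℝ) ((b + 1 : ℕ) : ℝ) :=
      (hcont.mono hsub').intervalIntegrable_of_Icc hbb
    rw [Finset.sum_Ioc_succ_top (by omega), Finset.sum_Ioc_succ_top (by omega),
      ← integral_add_adjacent_intervals hint1 hint2]
    -- the new piece: `‖h(b+1) − ∫_b^{b+1} h‖ ≤ D(b)/2`
    have hpiece : ‖h ((b + 1 : ℕ) : ℝ) - ∫ t in (b : ℝ)..((b + 1 : ℕ) : ℝ), h t‖ ≤
        1 / 2 * D b := by
      have hlip : ∀ t ∈ Icc (b : ℝ) ((b + 1 : ℕ) : ℝ),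
          ‖h ((b + 1 : ℕ) : ℝ) - h t‖ ≤ D b * (((b + 1 : ℕ) : ℝ) - t) := by
        intro t ht
        have hconv : Convex ℝ (Icc (b : ℝ) ((b + 1 : ℕ) : ℝ)) := convex_Icc _ _
        have hder : ∀ x ∈ Icc (b : ℝ) ((b + 1 : ℕ) : ℝ),
            HasDerivWithinAt h (h' x) (Icc (b : ℝ) ((b + 1 : ℕ) : ℝ)) x :=
          fun x hx ↦ (hderiv x (hsub' hx)).hasDerivWithinAt
        have hbound : ∀ x ∈ Icc (b : ℝ) ((b + 1 : ℕ) : ℝ), ‖h' x‖ ≤ D b := fun x hx ↦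
          (hD x (hsub' hx)).trans (hDanti (hsub' ⟨le_rfl, hbb⟩) (hsub' hx) hx.1)
        have := hconv.norm_image_sub_le_of_norm_hasDerivWithin_le hder hbound ht ⟨hbb, le_rfl⟩
        rw [Real.norm_eq_abs, abs_of_nonneg (by linarith [ht.2])] at this
        exact this
      have heq : h ((b + 1 : ℕ) : ℝ) - ∫ t in (b : ℝ)..((b + 1 : ℕ) : ℝ), h t =
          ∫ t in (b : ℝ)..((b + 1 : ℕ) : ℝ), (h ((b + 1 : ℕ) : ℝ) - h t) := by
        rw [intervalIntegral.integral_sub intervalIntegrable_const hint2, intervalIntegral.integral_const]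
        have h1 : (((b + 1 : ℕ) : ℝ) - (b : ℝ)) = 1 := by push_cast; ring
        rw [h1, one_smul]
      rw [heq]
      have hib : IntervalIntegrable (fun t : ℝ ↦ D b * (((b + 1 : ℕ) : ℝ) - t)) volume
          (b : ℝ) ((b + 1 : ℕ) : ℝ) :=
        (continuous_const.mul (continuous_const.sub continuous_id)).intervalIntegrable _ _
      refine (norm_integral_le_of_norm_le hbb (Filter.Eventually.of_forall fun t ht ↦
        hlip t ⟨ht.1.le, ht.2⟩) hib).trans (le_of_eq ?_)
      rw [intervalIntegral.integral_const_mul, intervalIntegral.integral_sub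
        intervalIntegrable_const intervalIntegrable_id, intervalIntegral.integral_const, integral_id]
      push_cast
      ring
    have hDb : D (((b + 1 : ℕ) : ℝ) - 1) = D b := by push_cast; ring_nf
    calc ‖∑ n ∈ Finset.Ioc a b, h n + h ((b + 1 : ℕ) : ℝ) -
          ((∫ t in (a : ℝ)..b, h t) + ∫ t in (b : ℝ)..((b + 1 : ℕ) : ℝ), h t)‖
        = ‖(∑ n ∈ Finset.Ioc a b, h n - ∫ t in (a : ℝ)..b, h t) +
            (h ((b + 1 : ℕ) : ℝ) - ∫ t in (b : ℝ)..((b + 1 : ℕ) : ℝ), h t)‖ := by ring_nf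
      _ ≤ ‖∑ n ∈ Finset.Ioc a b, h n - ∫ t in (a : ℝ)..b, h t‖ +
            ‖h ((b + 1 : ℕ) : ℝ) - ∫ t in (b : ℝ)..((b + 1 : ℕ) : ℝ), h t‖ := norm_add_le _ _
      _ ≤ 1 / 2 * ∑ n ∈ Finset.Ioc a b, D ((n : ℝ) - 1) + 1 / 2 * D b := add_le_add ih' hpiece
      _ = 1 / 2 * (∑ n ∈ Finset.Ioc a b, D ((n : ℝ) - 1) + D (((b + 1 : ℕ) : ℝ) - 1)) := by
          rw [hDb]; ring

/-! ## Weighted variation against an integral -/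

/-- Integrability on `[a, b]` from integrability on the unit pieces `[n, n+1]`. [folklore] -/
theorem intervalIntegrable_of_unit_pieces {f : ℝ → ℝ} {a b : ℕ} (hab : a ≤ b)
    (hint : ∀ n : ℕ, a ≤ n → n < b → IntervalIntegrable f volume n (n + 1)) :
    IntervalIntegrable f volume a b := by
  induction b, hab using Nat.le_induction with
  | base => simp
  | succ b hb ih =>
    have h1 := ih fun n h1 h2 ↦ hint n h1 (by omega)
    have h2 := hint b hb (by omega)
    push_cast
    exact h1.trans h2

/-- **`∑_{a≤n<b} e(n)‖g(n+1) − g(n)‖ ≤ ∫_a^b e·P`** when `‖g(n+1) − g(n)‖ ≤ ∫_n^{n+1} P`, `P ≥ 0`,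
`e ≥ 0` and `e` is non-decreasing (`e(n) ≤ e(t)` for `n ≤ t`). [folklore] -/
theorem sum_mul_norm_sub_le_integral {g : ℕ → ℂ} {e P : ℝ → ℝ} {a b : ℕ} (hab : a ≤ b)
    (hg : ∀ n : ℕ, a ≤ n → n < b → ‖g (n + 1) - g n‖ ≤ ∫ t in (n : ℝ)..(n + 1), P t)
    (hP : ∀ t : ℝ, (a : ℝ) ≤ t → 0 ≤ P t)
    (he : ∀ n : ℕ, a ≤ n → ∀ t : ℝ, (n : ℝ) ≤ t → e n ≤ e t)
    (he0 : ∀ n : ℕ, a ≤ n → 0 ≤ e n)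
    (hint : ∀ n : ℕ, a ≤ n → n < b → IntervalIntegrable (fun t ↦ e t * P t) volume n (n + 1))
    (hintP : ∀ n : ℕ, a ≤ n → n < b → IntervalIntegrable P volume n (n + 1)) :
    ∑ n ∈ Finset.Ico a b, e n * ‖g (n + 1) - g n‖ ≤ ∫ t in (a : ℝ)..b, e t * P t := by
  induction b, hab using Nat.le_induction with
  | base => simp
  | succ b hb ih =>
    have ih' := ih (fun n h1 h2 ↦ hg n h1 (by omega)) (fun n h1 h2 ↦ hint n h1 (by omega))
      (fun n h1 h2 ↦ hintP n h1 (by omega))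
    have hstep : e b * ‖g (b + 1) - g b‖ ≤ ∫ t in (b : ℝ)..(b + 1), e t * P t := by
      have h1 : e b * ‖g (b + 1) - g b‖ ≤ e b * ∫ t in (b : ℝ)..(b + 1), P t :=
        mul_le_mul_of_nonneg_left (hg b hb (by omega)) (he0 b hb)
      refine h1.trans ?_
      rw [← intervalIntegral.integral_const_mul]
      refine intervalIntegral.integral_mono_on (by linarith) ((hintP b hb (by omega)).const_mul _)
        (hint b hb (by omega)) fun t ht ↦ ?_
      exact mul_le_mul_of_nonneg_right (he b hb t ht.1)
        (hP t (le_trans (by exact_mod_cast hb) ht.1))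
    have hadj : ∫ t in (a : ℝ)..((b + 1 : ℕ) : ℝ), e t * P t =
        (∫ t in (a : ℝ)..b, e t * P t) + ∫ t in (b : ℝ)..(b + 1), e t * P t := by
      push_cast
      rw [integral_add_adjacent_intervals]
      · exact intervalIntegrable_of_unit_pieces hb fun n h1 h2 ↦ hint n h1 (by omega)
      · exact hint b hb (by omega)
    rw [Finset.sum_Ico_succ_top hb, hadj]
    exact add_le_add ih' hstep

end TuranShift

end Literature.Barriers.RiemannHypothesis
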